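import Literature.MathematicalPhysics.QuantumFieldTheory.Balaban1983to89.B8Ineq159CurvedCubeMemberPerCube
import Literature.MathematicalPhysics.QuantumFieldTheory.Balaban1983to89.B9Eq332FieldAvgCovariance
import Literature.MathematicalPhysics.QuantumFieldTheory.Balaban1983to89.B9Eq340HolderZd
import Literature.MathematicalPhysics.QuantumFieldTheory.Balaban1983to89.B7Prop6Flat

/-!
# `Balaban1983to89.B8Ineq159GaugeCovariance` — [Balaban1985RegularSpaces] p. 77 («the space 𝔄_k({Ω_j}, α₀) is invariant with respect to gauge
# transformations»), (1.11), (1.29) p. 81, (1.38) p. 82, (1.59) p. 86 ∕ [Balaban1985BackgroundPropagators] (3.19) p. 393, (3.23)–(3.25) p. 394 ∕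
# [Balaban1985Averaging] (11) p. 19, (56) p. 27: GAUGE COVARIANCE OF THE WHOLE (1.59) PACKAGE on `ℤᵈ × 𝔸` — current `J_{U₀}`, Laplacian, the multiplier
# form of the Landau condition (1.38) with the transpose tower `Q′(U₀)ᵀ`, the linearised averages `Q_j(U₀)` — and the per-member CURVED (1.59) at every
# background GAUGE-EQUIVALENT to a `δ₀`-close one (file (E) of the per-member curved (1.59))

statement-level skeleton of published theorems with citation tags; proofs where landed; nothing here is a claim about the
Yang–Mills mass gap

`[Balaban1985RegularSpaces]` ("B8", CMP **99** (1985) 75–102) p. 77, (1.11) p. 78, (1.29) p. 81, (1.38) p. 82, (1.59) p. 86, (1.62) p. 87, (1.131) p. 99;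
[4] = `[Balaban1985BackgroundPropagators]` (CMP **99** (1985) 389–434) (3.19) p. 393, (3.23)–(3.25) p. 394, (3.32) p. 395, Thm 3.3 p. 399; [B7] =
`[Balaban1985Averaging]` (CMP **98** (1985) 17–51) (11) p. 19, (56) p. 27, (78)–(80) p. 30, (127) p. 37.

CITATION HEADER (lean-in-tree rule).  Cell `pub-ymgap` (YM Track A, HUMAN RULING D-0062 ∕ D-0149), DAG node N05 = [B8], width seat `pub-ymgap-dag-n05-w3`
(g2), CLAIM-1 file (E).  WHY.  Files (D)∕(D′) (`B8Ineq159CurvedCubeMemberPerCube(Tower)`) give the per-member (1.59) at backgrounds `δ₀`-close to `1`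
BONDWISE IN THE GIVEN GAUGE; the sockets quantify over the GAUGE-INVARIANT small-field class `𝔄_k(α₀)` (p. 77).  Print bridges the two by gauge covariance
(every operator of (1.59) is conjugated by the gauge function, norms are unchanged) plus an axial gauge in which a small-field background is close to `1`
(Lemma 1 p. 79).  THIS FILE proves the covariance of the whole package on the tree's `ℤᵈ × 𝔸` carriers — by name where the tree has it (`covDerivFwd_gaugeAct`,
`covDeriv_gaugeAct`, `linCovIter_rot`, `avgIter_gaugeAct_units`, `hol_gaugeAct`), new for the plaquette derivative, the current, the Laplacian stencils, the
TRANSPOSE TOWER `Q′(U₀)ᵀ` (levels `j`, with the level gauge `u_j(z) = u(Lʲz)` on the multipliers) and the multiplier form of (1.38) — and transfers file (D):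
★★ `exists_curved159_perCube_truncOne_gauge` = (1.59) at truncation `m = 1`, per member, at EVERY background `u·V·u⁻¹` with `V` `δ₀(□)`-close to `1` and `u`
unit-bounded.  The remaining step to `𝔄_k(α₀)` is print's Lemma 1 (an axial gauge for `V`), not here.

THE MATHEMATICS (kernel-checked; `u : ℤᵈ → 𝔸ˣ` ANY gauge function for the identities, `U1`-valued for the norm statements).  With `A^u(x, κ) = R(u(x))A(x, κ)`:
* §1 `plaqCovDeriv_gaugeAct` · `pdiv_gaugeAct` · ★ `Jcur_gaugeAct` (`J_{U₀^u}(A^u)(x) = R(u(x))J_{U₀}(A)(x)`) · `covDivB_gaugeAct` · `covLap_gaugeAct` · `indicator_rot` ·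
  `landauStencil_gaugeAct`.
* §2 the transpose tower: `bgT_gaugeAct` (`Ū^u` transporters, via `avgIter_gaugeAct_units` + `hol_gaugeAct`) · `qprimeT1_gaugeAct` · ★ `QprimeT_gaugeAct`
  (`Q′_j(U₀^u)ᵀν = R(u)·Q′_j(U₀)ᵀ(R(u_j)⁻¹ν)`) · ★ `QT_gaugeAct` · ★ `isLandau138_gaugeAct_iff` ((1.38) in multiplier form is gauge covariant, multipliers rotated
  by the level gauges).
* §3 norms: `B8Ineq132.norm_conjR` (`‖R(u)X‖ = ‖X‖` on `U1`) BY NAME.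
* §4∕§3 ★★ `exists_curved159_perCube_truncOne_gauge` — file (D)'s conclusion at `U₀ = u·V·u⁻¹`, same `δ₀(□), B′(□)`.

HONEST SCOPE.  Algebraic identities + file (D) by transport; nothing new of [4]; still PER MEMBER with non-explicit constants, truncation `m = 1`, and the
hypothesis is «gauge-equivalent to a bondwise-`δ₀`-close background» — NOT YET `𝔄_k(α₀)` (needs Lemma 1's axial gauge, and `δ₀(□)` is member-dependent where
print's `α₀` is not); NOT an inhabitant of `SockB9P3` ∕ `SockH59` as typed; count-neutral; N05 NOT discharged; no count claim; one finite `𝕋⁴` programme at fixed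
`ε`, Bałaban as printed; the YM mass gap (Clay) is NOT proved by any of this — R4 closes the conditional finite-`𝕋⁴` rung `BalabanLadder.UV` only; nothing
continuum ∕ ℝ⁴ ∕ OS.  No `sorry`, no `def`, no `instance`, no `notation`.  Unit `pub-ymgap-dag-n05-w3` (g2), 2026-08-28.
-/

noncomputable section

namespace Literature.MathematicalPhysics.QuantumFieldTheory.Balaban1983to89.B8Ineq159GaugeCovariance

open B7Prop1Explicit B7Prop2Explicit B7Prop1Local
open B7Eq78Linearization (conjR conjR_apply conjR_sub conjR_smul conjR_smul_real)
open B7AvgGaugeCovariance (uLev uLev_zero uLev_smul)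
open B7Prop4GeneralLevels (linCovIter)
open B8Ineq132 (covDerivFwd covDeriv BondTouches conjR_conjR conjR_sum covDeriv_gaugeAct norm_conjR)
open B8Eq140Level (SideTouches)
open B8Eq143PlaqExpansion (pdiv)
open B8Eq146AExpansion (iEta plaqCovDeriv plaqCovDeriv_eq_covDerivFwd)
open B8Eq155JBound (Jcur)
open B8Eq138LandauZd (IsLandau138 covLap covDivB qprimeT1 QprimeT QT)
open B8Eq119TwistedAxial (bgT)
open B8Eq131CubesAdmissible (cubeFam)
open B8CubeMemberZd (cubeLamS)
open B8Ineq159FlatCubeMemberPrinted (cubeLamBP)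
open B9Eq340HolderZd (covDerivFwd_gaugeAct)
open B9Eq332FieldAvgCovariance (linCovIter_rot)
open B9Eq332AvgCovariance (conjR_inv_conjR)
open B7Prop6Flat (avgIter_gaugeAct_units)
open B8Ineq159CurvedCubeMemberPerCube (exists_curved159_perCube_truncOne)
open Literature.MathematicalPhysics.QuantumLattice (blockMap blockBase)

export B7Prop1Explicit (Site)

variable {d : ℕ} {𝔸 : Type*} [NormedRing 𝔸] [NormOneClass 𝔸] [NormedAlgebra ℂ 𝔸] [CompleteSpace 𝔸]

/-! ## §1 The local stencils under a gauge transformation -/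

section Local

variable (η : ℝ) (u : Site d → 𝔸ˣ) (V : Site d → Fin d → 𝔸ˣ)

omit [NormOneClass 𝔸] [CompleteSpace 𝔸] in
/-- **The plaquette derivative (3.4) is gauge covariant**: `(D^η_{V^u}A^u)(p) = R(u(x))(D^η_VA)(p)` at the base point `x` of `p`.
[cite: Balaban1985BackgroundPropagators, (3.4) p.391, (3.32) p.395; Balaban1985RegularSpaces, (1.11) p.78] -/
theorem plaqCovDeriv_gaugeAct (A : Site d → Fin d → 𝔸) (μ ν : Fin d) (x : Site d) :
    plaqCovDeriv η (gaugeAct u V) (fun z κ => conjR (u z) (A z κ)) μ ν x = conjR (u x) (plaqCovDeriv η V A μ ν x) := by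
  rw [plaqCovDeriv_eq_covDerivFwd, plaqCovDeriv_eq_covDerivFwd, conjR_sub,
    covDerivFwd_gaugeAct η u V μ (F := fun y => A y ν) (fun z => rfl),
    covDerivFwd_gaugeAct η u V ν (F := fun y => A y μ) (fun z => rfl)]

omit [NormOneClass 𝔸] [CompleteSpace 𝔸] in
/-- **`pdiv` is gauge covariant** on plaquette fields rotated at their base point. [cite: Balaban1985RegularSpaces, (1.2) p.76, (1.11) p.78] -/
theorem pdiv_gaugeAct {F Fu : Fin d → Fin d → Site d → 𝔸} (hF : ∀ κ κ' z, Fu κ κ' z = conjR (u z) (F κ κ' z)) (μ : Fin d) (x : Site d) :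
    pdiv η (gaugeAct u V) Fu μ x = conjR (u x) (pdiv η V F μ x) := by
  unfold pdiv
  rw [conjR_sub, conjR_sum, conjR_sum]
  congr 1
  · refine Finset.sum_congr rfl fun ν _ => ?_
    exact covDeriv_gaugeAct η u V ν (F := F ν μ) (fun z => hF ν μ z) x
  · refine Finset.sum_congr rfl fun ν _ => ?_
    exact covDeriv_gaugeAct η u V ν (F := F μ ν) (fun z => hF μ ν z) x

omit [NormOneClass 𝔸] [CompleteSpace 𝔸] in
/-- ★ **THE CURRENT (1.55) IS GAUGE COVARIANT**: `J_{V^u}(A^u)_μ(x) = R(u(x))J_V(A)_μ(x)` — p. 77's invariance for `D^{η*}_UD^η_UA`.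
[cite: Balaban1985RegularSpaces, (1.55) p.86, p.77, (1.11) p.78; Balaban1985BackgroundPropagators, (3.32) p.395] -/
theorem Jcur_gaugeAct (A : Site d → Fin d → 𝔸) (μ : Fin d) (x : Site d) :
    Jcur η (gaugeAct u V) (fun z κ => conjR (u z) (A z κ)) μ x = conjR (u x) (Jcur η V A μ x) := by
  rw [B8Eq155JBound.Jcur_def, B8Eq155JBound.Jcur_def]
  exact pdiv_gaugeAct η u V (fun κ κ' z => plaqCovDeriv_gaugeAct η u V A κ κ' z) μ x

omit [NormOneClass 𝔸] [CompleteSpace 𝔸] in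
/-- **The divergence `D^{η*}_V` on bond fields (1.38) is gauge covariant.** [cite: Balaban1985RegularSpaces, (1.38) p.82, (1.11) p.78] -/
theorem covDivB_gaugeAct (A : Site d → Fin d → 𝔸) (x : Site d) :
    covDivB η (gaugeAct u V) (fun z κ => conjR (u z) (A z κ)) x = conjR (u x) (covDivB η V A x) := by
  unfold covDivB
  rw [conjR_sum]
  exact Finset.sum_congr rfl fun ν _ => covDeriv_gaugeAct η u V ν (F := fun z => A z ν) (fun z => rfl) x

omit [NormOneClass 𝔸] [CompleteSpace 𝔸] in
/-- **The Laplacian (3.23) is gauge covariant** on site functions: `Δ^η_{V^u}(R(u)g) = R(u)Δ^η_Vg`. [cite: Balaban1985BackgroundPropagators, (3.23) p.394, (3.32) p.395] -/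
theorem covLap_gaugeAct (g : Site d → 𝔸) (x : Site d) :
    covLap η (gaugeAct u V) (fun z => conjR (u z) (g z)) x = conjR (u x) (covLap η V g x) := by
  unfold covLap
  have hgrad : (fun z μ => covDerivFwd η (gaugeAct u V) μ (fun z => conjR (u z) (g z)) z) =
      fun z μ => conjR (u z) (covDerivFwd η V μ g z) := by
    funext z μ
    exact covDerivFwd_gaugeAct η u V μ (F := g) (fun w => rfl) z
  rw [hgrad]
  exact covDivB_gaugeAct η u V _ x

omit [NormOneClass 𝔸] [NormedAlgebra ℂ 𝔸] [CompleteSpace 𝔸] in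
/-- Indicators commute with the rotation (`R(u)0 = 0`) — the Dirichlet cut-off `𝟙_{Ω₀}` of (3.25) under (3.32).
[cite: Balaban1985BackgroundPropagators, (3.25) p.394, (3.32) p.395] -/
theorem indicator_rot (S : Set (Site d)) (g : Site d → 𝔸) :
    S.indicator (fun z => conjR (u z) (g z)) = fun z => conjR (u z) (S.indicator g z) := by
  classical
  funext z
  by_cases hz : z ∈ S
  · rw [Set.indicator_of_mem hz, Set.indicator_of_mem hz]
  · rw [Set.indicator_of_notMem hz, Set.indicator_of_notMem hz, conjR_apply, mul_zero, zero_mul]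

omit [NormOneClass 𝔸] [CompleteSpace 𝔸] in
/-- **The Landau stencil of (1.38) is gauge covariant**: `Δ^η_{V^u}(𝟙_SD^{η*}_{V^u}A^u)(x) = R(u(x))Δ^η_V(𝟙_SD^{η*}_VA)(x)`.
[cite: Balaban1985RegularSpaces, (1.38) p.82, (1.11) p.78; Balaban1985BackgroundPropagators, (3.25) p.394, (3.32) p.395] -/
theorem landauStencil_gaugeAct (S : Set (Site d)) (A : Site d → Fin d → 𝔸) (x : Site d) :
    covLap η (gaugeAct u V) (S.indicator (covDivB η (gaugeAct u V) (fun z κ => conjR (u z) (A z κ)))) x =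
      conjR (u x) (covLap η V (S.indicator (covDivB η V A)) x) := by
  have h1 : covDivB η (gaugeAct u V) (fun z κ => conjR (u z) (A z κ)) = fun z => conjR (u z) (covDivB η V A z) :=
    funext fun z => covDivB_gaugeAct η u V A z
  rw [h1, indicator_rot]
  exact covLap_gaugeAct η u V _ x

end Local

/-! ## §2 The transpose tower `Q′(U₀)ᵀ` and the multiplier form of (1.38) under a gauge transformation -/

section Transpose

variable (L : ℕ) (u : Site d → 𝔸ˣ) (V : Site d → Fin d → 𝔸ˣ)

omit [NormOneClass 𝔸] in
/-- **The block transporters of the averaged backgrounds are gauge covariant**: `Ū^{u,j}(Γ_{Ly,x}) = u_j(Ly)·Ū^j(Γ_{Ly,x})·u_j(x)⁻¹` with the level gauge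
`u_j(z) = u(Lʲz)` ([B7] (11) for the contour holonomy, `avgIter_gaugeAct_units` for the averages). [cite: Balaban1985Averaging, (11) p.19, (78)–(80) p.30; Balaban1985RegularSpaces, (1.29) p.81] -/
theorem bgT_gaugeAct (j : ℕ) (y x : Site d) :
    bgT L (gaugeAct u V) j y x = uLev L u j (blockBase L y) * bgT L V j y x * (uLev L u j x)⁻¹ := by
  unfold bgT axialFn
  rw [avgIter_gaugeAct_units, hol_gaugeAct, disp_treeWord, add_sub_cancel]

omit [NormOneClass 𝔸] in
/-- **One step of the transpose is gauge covariant**: `(Q′(V^u)ᵀν)_j(x) = R(u_j(x))·(Q′(V)ᵀν′)_j(x)` with `ν′(y) = R(u_{j+1}(y))⁻¹ν(y)` (the multiplier lives on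
the next level). [cite: Balaban1985BackgroundPropagators, (3.19) p.393, (3.24) p.394, (3.32) p.395] -/
theorem qprimeT1_gaugeAct (j : ℕ) (ν : Site d → 𝔸) (x : Site d) :
    qprimeT1 L (gaugeAct u V) j ν x =
      conjR (uLev L u j x) (qprimeT1 L V j (fun y => conjR (uLev L u (j + 1) y)⁻¹ (ν y)) x) := by
  unfold qprimeT1
  rw [bgT_gaugeAct, conjR_smul_real, conjR_conjR, conjR_conjR]
  congr 1
  have hbase : blockBase L (blockMap L x) = (L : ℤ) • blockMap L x := by
    funext i; simp [blockBase, Pi.smul_apply]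
  rw [hbase, uLev_smul]
  congr 1
  rw [mul_inv_rev, mul_inv_rev, inv_inv, mul_assoc]

omit [NormOneClass 𝔸] in
/-- ★ **THE LEVEL-`j` TRANSPOSE IS GAUGE COVARIANT**: `(Q′_j(V^u)ᵀν)(x) = R(u(x))·(Q′_j(V)ᵀν′)(x)`, `ν′(y) = R(u_j(y))⁻¹ν(y)` — induction on the levels,
each step rotating the multiplier one level up. [cite: Balaban1985BackgroundPropagators, (3.19) p.393, (3.24) p.394, (3.32) p.395; Balaban1985RegularSpaces, (1.29) p.81] -/
theorem QprimeT_gaugeAct :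
    ∀ (j : ℕ) (ν : Site d → 𝔸) (x : Site d),
      QprimeT L (gaugeAct u V) j ν x = conjR (u x) (QprimeT L V j (fun y => conjR (uLev L u j y)⁻¹ (ν y)) x)
  | 0, ν, x => by
    show ν x = conjR (u x) (conjR (uLev L u 0 x)⁻¹ (ν x))
    rw [uLev_zero, conjR_conjR, mul_inv_cancel, B8Ineq132.one_conjR]
  | j + 1, ν, x => by
    show QprimeT L (gaugeAct u V) j (qprimeT1 L (gaugeAct u V) j ν) x =
      conjR (u x) (QprimeT L V j (qprimeT1 L V j (fun y => conjR (uLev L u (j + 1) y)⁻¹ (ν y))) x)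
    rw [QprimeT_gaugeAct j]
    congr 2
    funext y
    rw [qprimeT1_gaugeAct, conjR_inv_conjR]

omit [NormOneClass 𝔸] in
/-- ★ **THE TRANSPOSE `Q′(U₀)ᵀ` ON MULTIPLIERS IS GAUGE COVARIANT**: `(Q′(V^u)ᵀμ)(x) = R(u(x))·(Q′(V)ᵀμ′)(x)` with the level-wise rotated multiplier
`μ′_j(y) = R(u_j(y))⁻¹μ_j(y)`. [cite: Balaban1985BackgroundPropagators, (3.24) p.394, (3.32) p.395; Balaban1985RegularSpaces, (1.29) p.81, (1.38) p.82] -/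
theorem QT_gaugeAct (m : ℕ) (Λs : ℕ → Set (Site d)) (μ : ℕ → Site d → 𝔸) (x : Site d) :
    QT L m Λs (gaugeAct u V) μ x = conjR (u x) (QT L m Λs V (fun j y => conjR (uLev L u j y)⁻¹ (μ j y)) x) := by
  unfold QT
  rw [conjR_sum]
  refine Finset.sum_congr rfl fun j _ => ?_
  rw [QprimeT_gaugeAct]
  congr 2
  exact (indicator_rot (fun y => (uLev L u j y)⁻¹) (Λs j) (μ j)).symm

omit [NormOneClass 𝔸] in
/-- ★ **THE LANDAU CONDITION (1.38) IN MULTIPLIER FORM IS GAUGE COVARIANT**: `A^u` is in the Landau gauge of `V^u` iff `A` is in the Landau gauge of `V` (the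
multiplier is rotated level-wise). [cite: Balaban1985RegularSpaces, (1.38) p.82, p.77, (1.11) p.78; Balaban1985BackgroundPropagators, (3.25) p.394, (3.32) p.395] -/
theorem isLandau138_gaugeAct_iff (m : ℕ) (η : ℝ) (Ω₀ : Set (Site d)) (Λs : ℕ → Set (Site d)) (A : Site d → Fin d → 𝔸) :
    IsLandau138 L m η Ω₀ Λs (gaugeAct u V) (fun z κ => conjR (u z) (A z κ)) ↔ IsLandau138 L m η Ω₀ Λs V A := by
  constructor
  · rintro ⟨μ, hμ⟩
    refine ⟨fun j y => conjR (uLev L u j y)⁻¹ (μ j y), fun x hx => ?_⟩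
    have h := hμ x hx
    rw [landauStencil_gaugeAct, QT_gaugeAct] at h
    have h' := congrArg (conjR (u x)⁻¹) h
    rwa [conjR_inv_conjR, conjR_inv_conjR] at h'
  · rintro ⟨μ, hμ⟩
    refine ⟨fun j y => conjR (uLev L u j y) (μ j y), fun x hx => ?_⟩
    rw [landauStencil_gaugeAct, QT_gaugeAct, hμ x hx]
    congr 2
    funext j y
    rw [conjR_inv_conjR]

end Transpose

/-! ## §3 The per-member curved (1.59) at every background gauge-equivalent to a `δ₀`-close one -/

/-- ★★ **(1.59) AT A CURVED BACKGROUND ON THE CUBE MEMBER, PER MEMBER, TRUNCATION `m = 1`, FOR EVERY BACKGROUND GAUGE-EQUIVALENT TO A `δ₀`-CLOSE ONE.**  With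
the SAME `δ₀(□) > 0`, `B′(□) > 0` as `B8Ineq159CurvedCubeMemberPerCube.exists_curved159_perCube_truncOne`: for every gauge function `u` with `u(x) ∈ U1`, every
background `V` with `V(b) ∈ U1`, `‖V(b) − 1‖ ≤ δ₀` on all bonds, and `U₀ = V^u = u·V·u⁻¹`, every `𝔸`-valued `φ` in the CURVED Landau gauge of `U₀` at truncation
`1` supported on the side-touching bonds of `□₀ ∕ □₁`, and every `N ≥ 0` bounding (i) `(Lʲη)³|J_{U₀}φ|` on the bonds of `□_j`, (ii) `|Lʲη·Q_j(U₀)(iηφ)|` on print's class,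
(iii) `η|φ|` on the outer layer: `(Lʲη)|φ|, (Lʲη)²|D^η_{U₀,ν}φ_τ|, (Lʲη)³|Δ^η_{U₀}φ_τ| ≤ B′N` on the sides of `□_j` (`j ≤ 1`).  PROOF: transport `φ ↦ R(u)⁻¹φ` to the
background `V` (§1–§3: every datum and every target is rotated by a unit-bounded `R(·)`, norms unchanged; the Landau condition by `isLandau138_gaugeAct_iff`),
apply file (D), transport back.  HONEST SCOPE: per member, non-explicit constants, `m = 1`; «gauge-equivalent to bondwise-close» is NOT yet print's
`𝔄_k(α₀)` (Lemma 1's axial gauge + a member-independent window are not here); NOT a socket inhabitant; NOT [4] Thm 3.3.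
[cite: Balaban1985RegularSpaces, (1.59) p.86, (1.62) p.87, p.77, (1.11) p.78, (1.38) p.82, (1.131) p.99, Lemma 1 p.79; Balaban1985BackgroundPropagators, Thm 3.3 p.399, (3.32) p.395; Balaban1985Averaging, (11) p.19, (56) p.27] -/
theorem exists_curved159_perCube_truncOne_gauge [FiniteDimensional ℂ 𝔸] (hd2 : 2 ≤ d) {L : ℕ} (hL : 1 ≤ L) {η : ℝ} (hη : 0 < η)
    (a : Site d) (M ρ : ℕ) {k : ℕ} (hk : 1 ≤ k) :
    ∃ δ₀ B' : ℝ, 0 < δ₀ ∧ 0 < B' ∧ ∀ (u : Site d → 𝔸ˣ), (∀ x, u x ∈ U1 𝔸) →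
      ∀ (V : Site d → Fin d → 𝔸ˣ), (∀ x κ, V x κ ∈ U1 𝔸) → (∀ x κ, ‖((V x κ : 𝔸ˣ) : 𝔸) - 1‖ ≤ δ₀) →
      ∀ φ : Site d → Fin d → 𝔸,
        IsLandau138 L 1 η (cubeFam false L a M ρ k 0) (cubeLamS L a M ρ k 1) (gaugeAct u V) φ →
        (∀ (y : Site d) (τ : Fin d), (∀ j, j ≤ 1 → ¬ SideTouches (cubeFam false L a M ρ k j) y τ) → φ y τ = 0) →
        ∀ N : ℝ, 0 ≤ N →
          (∀ j, j ≤ 1 → ∀ (y : Site d) (τ : Fin d), BondTouches (cubeFam false L a M ρ k j) y τ →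
              ((L : ℝ) ^ j * η) ^ 3 * ‖Jcur η (gaugeAct u V) φ τ y‖ ≤ N) →
          (∀ j, j ≤ 1 → ∀ c ∈ cubeLamBP L a M ρ k 1 j, ‖linCovIter L (gaugeAct u V) (iEta η φ) j c.1 c.2‖ ≤ N) →
          (∀ (y : Site d) (τ : Fin d), ¬ BondTouches (cubeFam false L a M ρ k 0) y τ → η * ‖φ y τ‖ ≤ N) →
          ∀ j, j ≤ 1 → ∀ (y : Site d) (τ : Fin d), SideTouches (cubeFam false L a M ρ k j) y τ →
            ((L : ℝ) ^ j * η) * ‖φ y τ‖ ≤ B' * N ∧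
            (∀ ν : Fin d, ((L : ℝ) ^ j * η) ^ 2 * ‖covDerivFwd η (gaugeAct u V) ν (fun z => φ z τ) y‖ ≤ B' * N) ∧
            ((L : ℝ) ^ j * η) ^ 3 * ‖covLap η (gaugeAct u V) (fun z => φ z τ) y‖ ≤ B' * N := by
  obtain ⟨δ₀, B', hδ₀, hB', H⟩ := exists_curved159_perCube_truncOne (𝔸 := 𝔸) hd2 hL hη a M ρ hk
  refine ⟨δ₀, B', hδ₀, hB', ?_⟩
  intro u hu V hV hδ φ hLan hs N hN h1 h2 h3 j hj y τ hst
  -- the transported field `A = R(u)⁻¹φ`, so that `φ = A^u`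
  set A : Site d → Fin d → 𝔸 := fun z κ => conjR (u z)⁻¹ (φ z κ) with hA
  have hφA : φ = fun z κ => conjR (u z) (A z κ) := by
    funext z κ
    rw [hA]
    exact (conjR_inv_conjR (u z)⁻¹ (φ z κ)).symm.trans (by rw [inv_inv])
  have hnA : ∀ z κ, ‖A z κ‖ = ‖φ z κ‖ := fun z κ => by
    rw [hA]; exact norm_conjR ((U1 𝔸).inv_mem (hu z)) _
  -- hypotheses for `A` at the background `V`
  have hLanA : IsLandau138 L 1 η (cubeFam false L a M ρ k 0) (cubeLamS L a M ρ k 1) V A := by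
    rw [hφA] at hLan
    exact (isLandau138_gaugeAct_iff L u V 1 η _ _ A).1 hLan
  have hsA : ∀ (y : Site d) (τ : Fin d), (∀ j, j ≤ 1 → ¬ SideTouches (cubeFam false L a M ρ k j) y τ) → A y τ = 0 := by
    intro y' τ' h
    rw [hA]
    show conjR (u y')⁻¹ (φ y' τ') = 0
    rw [hs y' τ' h, conjR_apply, mul_zero, zero_mul]
  have h1A : ∀ j, j ≤ 1 → ∀ (y : Site d) (τ : Fin d), BondTouches (cubeFam false L a M ρ k j) y τ →
      ((L : ℝ) ^ j * η) ^ 3 * ‖Jcur η V A τ y‖ ≤ N := by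
    intro j' hj' y' τ' hbt
    have e : ‖Jcur η (gaugeAct u V) φ τ' y'‖ = ‖Jcur η V A τ' y'‖ := by
      rw [hφA, Jcur_gaugeAct]; exact norm_conjR (hu y') _
    rw [← e]; exact h1 j' hj' y' τ' hbt
  have h2A : ∀ j, j ≤ 1 → ∀ c ∈ cubeLamBP L a M ρ k 1 j, ‖linCovIter L V (iEta η A) j c.1 c.2‖ ≤ N := by
    intro j' hj' c hc
    have hi : iEta η φ = fun z κ => conjR (u z) (iEta η A z κ) := by
      funext z κ
      rw [hφA]
      simp only [B8Eq146AExpansion.iEta_def, conjR_smul]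
    have e : ‖linCovIter L (gaugeAct u V) (iEta η φ) j' c.1 c.2‖ = ‖linCovIter L V (iEta η A) j' c.1 c.2‖ := by
      rw [hi, linCovIter_rot]
      exact norm_conjR (hu _) _
    rw [← e]; exact h2 j' hj' c hc
  have h3A : ∀ (y : Site d) (τ : Fin d), ¬ BondTouches (cubeFam false L a M ρ k 0) y τ → η * ‖A y τ‖ ≤ N := by
    intro y' τ' h; rw [hnA]; exact h3 y' τ' h
  -- file (D) at `V`, transported back
  obtain ⟨t1, t2, t3⟩ := H V hV hδ A hLanA hsA N hN h1A h2A h3A j hj y τ hst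
  refine ⟨by rw [← hnA]; exact t1, fun ν => ?_, ?_⟩
  · have e : ‖covDerivFwd η (gaugeAct u V) ν (fun z => φ z τ) y‖ = ‖covDerivFwd η V ν (fun z => A z τ) y‖ := by
      rw [covDerivFwd_gaugeAct η u V ν (F := fun z => A z τ) (fun z => by rw [hφA])]
      exact norm_conjR (hu y) _
    rw [e]; exact t2 ν
  · have e : ‖covLap η (gaugeAct u V) (fun z => φ z τ) y‖ = ‖covLap η V (fun z => A z τ) y‖ := by
      have hfun : (fun z => φ z τ) = fun z => conjR (u z) (A z τ) := by funext z; rw [hφA]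
      rw [hfun, covLap_gaugeAct]
      exact norm_conjR (hu y) _
    rw [e]; exact t3

end Literature.MathematicalPhysics.QuantumFieldTheory.Balaban1983to89.B8Ineq159GaugeCovariance

end
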